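import Summits.MatrixMultiplication.MatrixMultiplication.Theses.CatalyticDegeneration

/-!
# MatrixMultiplication / CatalyticDegeneration — the assembly `Assembly` (stmt-MatrixMultiplication-3640)

Route `MatrixMultiplication/CatalyticDegeneration`, item stmt-MatrixMultiplication-3640 (`Assembly`,
rank 1):

  `CatalyticTransfer → CatalyticRate → MatrixMultiplication`.

Proof (pure glue, self-contained; it is also, verbatim, the content of the route's kernel-checked
deciding theorem `Summit.MatrixMultiplication.MatrixMultiplication.Theses.CatalyticDegeneration.closes`).
Given `δ > 0`, `CatalyticRate` at `ε = δ/2` yields `k ≥ 1`, `r ≥ 1` with `r ≤ 4^{(1+δ/2)k}` and a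
bystander `C` with `⟨r⟩ ⊕ C ⊵ ⟨2^k,2^k,2^k⟩ ⊕ C`; `CatalyticTransfer` at `n = 2^k ≥ 2` gives
`ω(ℂ) ≤ log_{2^k} r = log r / (k log 2) ≤ (1+δ/2)·k·(2 log 2) / (k log 2) = 2 + δ`. Hence
`ω(ℂ) ≤ 2`; with `2 ≤ ω(ℂ)` (`omega_two_le`, flattening bound) this is `ω(ℂ) = 2`, i.e.
`MatrixMultiplication` (`MatrixMultiplication_iff`).

References: M. Bläser, *Fast Matrix Multiplication*, Theory of Computing Graduate Surveys 5 (2013),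
§5–§6 (Bini / Schönhage transfer of a single identity to a bound on `ω`).
-/

-- the tree's namespace `Summit.MatrixMultiplication.MatrixMultiplication.…` repeats a component by design (D-0017)
set_option linter.dupNamespace false

namespace Summit.MatrixMultiplication.MatrixMultiplication.Theorems

open Summit.MatrixMultiplication.MatrixMultiplication.Theses.CatalyticDegeneration
open Literature.Computability.AlgebraicComplexity

/-- Arithmetic of the transfer: if `1 ≤ k`, `1 ≤ r` and `r ≤ 4^{(1+δ/2)k}` (real exponent), then
`log_{2^k} r ≤ 2 + δ`. [folklore] -/
theorem catalyticDegeneration_logb_pow_two_le {k r : ℕ} {δ : ℝ} (hk : 1 ≤ k) (hr : 1 ≤ r)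
    (hrle : (r : ℝ) ≤ (4 : ℝ) ^ ((1 + δ / 2) * k)) :
    Real.logb ((2 : ℕ) ^ k : ℕ) r ≤ 2 + δ := by
  have hk0 : (0 : ℝ) < k := by exact_mod_cast hk
  have hlog2 : 0 < Real.log 2 := Real.log_pos (by norm_num)
  have hr0 : (0 : ℝ) < r := by exact_mod_cast hr
  have h4 : Real.log (r : ℝ) ≤ (1 + δ / 2) * k * Real.log 4 := by
    have := Real.log_le_log hr0 hrle
    rwa [Real.log_rpow (by norm_num : (0 : ℝ) < 4)] at this
  have hlog4 : Real.log 4 = 2 * Real.log 2 := by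
    rw [show (4 : ℝ) = 2 ^ 2 by norm_num, Real.log_pow]; norm_num
  rw [hlog4] at h4
  have hbpos : 0 < Real.log ((2 : ℝ) ^ k) := by
    rw [Real.log_pow]; positivity
  push_cast
  rw [Real.logb, div_le_iff₀ hbpos, Real.log_pow]
  calc Real.log (r : ℝ) ≤ (1 + δ / 2) * k * (2 * Real.log 2) := h4
    _ = (2 + δ) * (k * Real.log 2) := by ring

/-- From the two hypotheses of the route: `CatalyticTransfer` and `CatalyticRate` give
`ω(ℂ) ≤ 2 + δ` for every `δ > 0` (rate at `ε = δ/2`, transfer at `n = 2^k ≥ 2`).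
[cite: Blaser2013, §5–§6] -/
theorem catalyticDegeneration_omega_le_two_add (hT : CatalyticTransfer) (hR : CatalyticRate)
    {δ : ℝ} (hδ : 0 < δ) : omega ℂ ≤ 2 + δ := by
  obtain ⟨k, r, a, b, c, C, hk, hr, hrle, hdeg⟩ := hR (δ / 2) (by positivity)
  have hn : 2 ≤ 2 ^ k :=
    calc 2 = 2 ^ 1 := (pow_one 2).symm
      _ ≤ 2 ^ k := Nat.pow_le_pow_right (by norm_num) hk
  exact (hT (2 ^ k) r a b c C hn hr hdeg).trans (catalyticDegeneration_logb_pow_two_le hk hr hrle)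

/-- **Assembly of route CatalyticDegeneration** (item stmt-MatrixMultiplication-3640):
`CatalyticTransfer → CatalyticRate → MatrixMultiplication`. A catalytic identity
`⟨r⟩ ⊕ C ⊵ ⟨2^k,2^k,2^k⟩ ⊕ C` with `r ≤ 4^{(1+δ/2)k}` (the rate) read through the catalytic
Bini–Schönhage transfer `ω(ℂ) ≤ log_{2^k} r` gives `ω(ℂ) ≤ 2 + δ` for every `δ > 0`, so
`ω(ℂ) ≤ 2`; `ω(ℂ) ≥ 2` (flattening bound, `omega_two_le`) makes it `ω(ℂ) = 2`, which is
`MatrixMultiplication` (`MatrixMultiplication_iff`). The statement is literally the type of the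
route's deciding theorem `Theses.CatalyticDegeneration.closes`; the proof here is self-contained.
[cite: Blaser2013, §5–§6] -/
theorem catalyticDegeneration_assembly_proof :
    Summit.MatrixMultiplication.MatrixMultiplication.Theses.CatalyticDegeneration.Assembly := by
  unfold Summit.MatrixMultiplication.MatrixMultiplication.Theses.CatalyticDegeneration.Assembly
  intro hT hR
  rw [_root_.MatrixMultiplication_iff]
  refine le_antisymm ?_ (omega_two_le ℂ)
  exact le_of_forall_pos_le_add fun δ hδ => catalyticDegeneration_omega_le_two_add hT hR hδ

end Summit.MatrixMultiplication.MatrixMultiplication.Theorems
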